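import Summits.BirchSwinnertonDyer.BirchSwinnertonDyer.Theorems.CMKolyvaginAtInertTwoLagrangianTransversal
import HarnessLib

/-!
# Route `CMKolyvaginAtInertTwo`, crux `CMKolyvaginExactAtInertTwo` (stmt-BirchSwinnertonDyer-24277):
# LEMMAS FOR THE LAYERED TRANSVERSAL LAGRANGIAN (T5′, doubly-filtered case, KERNEL-STATUS §13.3)

Seat `bsd-line-cmk2-p1` g14 (cell `bsd-print-cf2`); helper (`--supports stmt-BirchSwinnertonDyer-24277`).
THEOREMS ONLY: no definition, no named fact, no `sorry`; no item is closed; BSD is not proved by this.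
Pure finite-abelian-group algebra; the counting lemmas used by the induction step of the sequel
`…LagrangianTransversalLayered` (a Lagrangian of a filtered symplectic module avoiding a subgroup
`Y ≤ T[p]` that satisfies the layered condition `(#(Y ∩ p^jT))² ≤ #(p^jT ∩ T[p])` for all `j`):
for a hyperbolic plane `H = ⟨f, e⟩` of order `(p^{a+1})²` with complement `H^⊥` (Wall's Lemma 1),

* `exists_not_mem_not_mem` — a group is not the union of two proper subgroups;
* `mem_zmultiples_nsmul_of_nsmul_eq_zero`, `card_plane_inf_ker_le` — the `p`-torsion of `⟨f⟩` is
  `⟨p^a f⟩`; `#(H ∩ T[p]) ≤ p²`;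
* `card_range_inf_ker_le_of_isCompl` — layers descend to a complement: `#(p^jT ∩ T[p]) ≤
  #(p^jH^⊥ ∩ H^⊥[p]) · #(H ∩ T[p])`;
* `card_inf_ker_mul_le` — if `B(·, f) ≢ 0` on a `p`-torsion subgroup `Z`, then
  `#(Z ∩ f^⊥) · p ≤ #Z`;
* `trace_nsmul_eq_zero`, `card_trace_inf_range_le` — the trace `Y' = (Y + ⟨f⟩) ∩ H^⊥` of `Y ≤ T[p]`
  is `p`-torsion and `#(Y' ∩ p^jH^⊥) ≤ #(Y ∩ f^⊥ ∩ p^jT)` for `j ≤ a`.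

References: [Wall1963QuadraticFormsFiniteGroups] Lemma 1; [TignolAmitsur1986SymplecticModules] §2.
-/

-- single-conjunct summit: `Summit.BirchSwinnertonDyer.BirchSwinnertonDyer.…` repeats the name by design
set_option linter.dupNamespace false
set_option autoImplicit false

noncomputable section

open AddSubgroup Literature.GroupTheory.FiniteAbelian

namespace Summit.BirchSwinnertonDyer.BirchSwinnertonDyer.Theorems.KolyvaginLiftGroupsTwo

universe u v

section LayeredLemmas

variable {T : Type u} [AddCommGroup T] (B : T →+ T →+ AddCircle (1 : ℚ))

/-- A group is not the union of two proper subgroups. [folklore] -/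
theorem exists_not_mem_not_mem {U V : AddSubgroup T} (hU : U ≠ ⊤) (hV : V ≠ ⊤) :
    ∃ t : T, t ∉ U ∧ t ∉ V := by
  obtain ⟨a, haU⟩ : ∃ a : T, a ∉ U := by
    by_contra h
    push Not at h
    exact hU (eq_top_iff.mpr fun t _ ↦ h t)
  obtain ⟨b, hbV⟩ : ∃ b : T, b ∉ V := by
    by_contra h
    push Not at h
    exact hV (eq_top_iff.mpr fun t _ ↦ h t)
  by_cases haV : a ∈ V
  · by_cases hbU : b ∈ U
    · refine ⟨a + b, fun h ↦ haU ?_, fun h ↦ hbV ?_⟩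
      · have := U.sub_mem h hbU; rwa [add_sub_cancel_right] at this
      · have := V.sub_mem h haV; rwa [add_sub_cancel_left] at this
    · exact ⟨b, hbU, hbV⟩
  · exact ⟨a, haU, haV⟩

/-- `p^{j'} T ≤ p^j T` for `j ≤ j'`. [folklore] -/
theorem range_nsmul_pow_le {p j j' : ℕ} (h : j ≤ j') :
    (nsmulAddMonoidHom (p ^ j') : T →+ T).range ≤ (nsmulAddMonoidHom (p ^ j) : T →+ T).range := by
  rintro t ⟨s, rfl⟩
  refine ⟨(p ^ (j' - j)) • s, ?_⟩
  simp only [nsmulAddMonoidHom_apply, smul_smul, ← pow_add, Nat.add_sub_cancel' h]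

/-- `#G = #ker ψ · #range ψ` for a homomorphism out of a finite group. [folklore] -/
theorem card_eq_card_ker_mul_card_range {G : Type*} [AddCommGroup G] [Finite G]
    {Q : Type*} [AddCommGroup Q] (ψ : G →+ Q) :
    Nat.card G = Nat.card ψ.ker * Nat.card ψ.range := by
  rw [AddSubgroup.card_eq_card_quotient_mul_card_addSubgroup ψ.ker, mul_comm,
    Nat.card_congr (QuotientAddGroup.quotientKerEquivRange ψ).toEquiv]

/-- A multiple `w ∈ ⟨f⟩` with `p · w = 0`, where `f` has order `p^{a+1}`, is a multiple of
`p^a · f`. [folklore] -/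
theorem mem_zmultiples_nsmul_of_nsmul_eq_zero {p : ℕ} (hp : p.Prime) {a : ℕ} {f w : T}
    (hf : addOrderOf f = p ^ (a + 1)) (hw : w ∈ zmultiples f) (hpw : p • w = 0) :
    w ∈ zmultiples ((p ^ a) • f) := by
  obtain ⟨c, rfl⟩ := AddSubgroup.mem_zmultiples_iff.mp hw
  have h1 : ((p : ℤ) * c) • f = 0 := by rw [mul_zsmul, natCast_zsmul, hpw]
  have h2 : ((p ^ (a + 1) : ℕ) : ℤ) ∣ (p : ℤ) * c := by
    rw [← hf]; exact addOrderOf_dvd_iff_zsmul_eq_zero.mpr h1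
  have h3 : ((p ^ a : ℕ) : ℤ) ∣ c := by
    rw [Nat.cast_pow] at h2 ⊢
    rw [pow_succ, mul_comm ((p : ℤ) ^ a)] at h2
    exact (mul_dvd_mul_iff_left (by exact_mod_cast hp.ne_zero)).mp h2
  obtain ⟨c', rfl⟩ := h3
  refine AddSubgroup.mem_zmultiples_iff.mpr ⟨c', ?_⟩
  rw [mul_comm, mul_zsmul, natCast_zsmul]

/-- `p^a · f` has order `p` when `f` has order `p^{a+1}`. [folklore] -/
theorem addOrderOf_nsmul_pow_eq {p : ℕ} (hp : p.Prime) {a : ℕ} {f : T}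
    (hf : addOrderOf f = p ^ (a + 1)) : addOrderOf ((p ^ a) • f) = p := by
  haveI : Fact p.Prime := ⟨hp⟩
  refine addOrderOf_eq_prime ?_ ?_
  · rw [smul_smul, ← pow_succ', ← hf, addOrderOf_nsmul_eq_zero]
  · intro h
    have : addOrderOf f ∣ p ^ a := addOrderOf_dvd_of_nsmul_eq_zero h
    rw [hf, Nat.pow_dvd_pow_iff_le_right hp.one_lt] at this
    omega

/-- **`#(H ∩ T[p]) ≤ p²` for a plane `H = ⟨f⟩ ⊕ ⟨e⟩` with `f, e` of order `p^{a+1}`.** [folklore] -/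
theorem card_plane_inf_ker_le [Finite T] {p : ℕ} (hp : p.Prime) {a : ℕ} {f e : T}
    (hf : addOrderOf f = p ^ (a + 1)) (he : addOrderOf e = p ^ (a + 1))
    (hdisj : Disjoint (zmultiples f) (zmultiples e)) :
    Nat.card ↥((zmultiples f ⊔ zmultiples e) ⊓ (nsmulAddMonoidHom p : T →+ T).ker) ≤ p * p := by
  have hle : (zmultiples f ⊔ zmultiples e) ⊓ (nsmulAddMonoidHom p : T →+ T).ker ≤
      zmultiples ((p ^ a) • f) ⊔ zmultiples ((p ^ a) • e) := by
    intro h hh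
    obtain ⟨hH, hTp⟩ := AddSubgroup.mem_inf.mp hh
    obtain ⟨w₁, hw₁, w₂, hw₂, rfl⟩ := AddSubgroup.mem_sup.mp hH
    rw [AddMonoidHom.mem_ker, nsmulAddMonoidHom_apply, smul_add] at hTp
    have h1 : p • w₁ ∈ zmultiples f := AddSubgroup.nsmul_mem _ hw₁ _
    have h2 : p • w₁ ∈ zmultiples e := by
      have : p • w₁ = -(p • w₂) := eq_neg_of_add_eq_zero_left hTp
      rw [this]; exact AddSubgroup.neg_mem _ (AddSubgroup.nsmul_mem _ hw₂ _)
    have hpw₁ : p • w₁ = 0 := (AddSubgroup.disjoint_def.mp hdisj) h1 h2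
    have hpw₂ : p • w₂ = 0 := by rwa [hpw₁, zero_add] at hTp
    exact AddSubgroup.add_mem _
      (AddSubgroup.mem_sup_left (mem_zmultiples_nsmul_of_nsmul_eq_zero hp hf hw₁ hpw₁))
      (AddSubgroup.mem_sup_right (mem_zmultiples_nsmul_of_nsmul_eq_zero hp he hw₂ hpw₂))
  refine (AddSubgroup.card_le_of_le hle).trans ((card_sup_le_mul _ _).trans ?_)
  rw [Nat.card_zmultiples, Nat.card_zmultiples, addOrderOf_nsmul_pow_eq hp hf,
    addOrderOf_nsmul_pow_eq hp he]

/-- **Layers descend to a complement.** For complementary subgroups `T = H ⊕ H'`: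
`#(p^jT ∩ T[p]) ≤ #(p^jH' ∩ H'[p]) · #(H ∩ T[p])` (the `p`-torsion of `p^jT` splits along the
decomposition). [folklore] -/
theorem card_range_inf_ker_le_of_isCompl [Finite T] {H H' : AddSubgroup T} (hc : IsCompl H H')
    (p j : ℕ) :
    Nat.card ↥((nsmulAddMonoidHom (p ^ j) : T →+ T).range ⊓ (nsmulAddMonoidHom p : T →+ T).ker) ≤
      Nat.card ↥((nsmulAddMonoidHom (p ^ j) : H' →+ H').range ⊓ (nsmulAddMonoidHom p : H' →+ H').ker) *
        Nat.card ↥(H ⊓ (nsmulAddMonoidHom p : T →+ T).ker) := by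
  set F' : AddSubgroup H' :=
    (nsmulAddMonoidHom (p ^ j) : H' →+ H').range ⊓ (nsmulAddMonoidHom p : H' →+ H').ker with hF'_def
  have hHH' : ∀ t, t ∈ H → t ∈ H' → t = 0 := fun t h1 h2 ↦
    (AddSubgroup.disjoint_def.mp hc.disjoint) h1 h2
  have hle : (nsmulAddMonoidHom (p ^ j) : T →+ T).range ⊓ (nsmulAddMonoidHom p : T →+ T).ker ≤
      F'.map H'.subtype ⊔ (H ⊓ (nsmulAddMonoidHom p : T →+ T).ker) := by
    intro x hx
    obtain ⟨hxR, hxTp⟩ := AddSubgroup.mem_inf.mp hx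
    obtain ⟨s, rfl⟩ := hxR
    have hs : s ∈ H ⊔ H' := by rw [hc.sup_eq_top]; exact AddSubgroup.mem_top s
    obtain ⟨s₁, hs₁, s₂, hs₂, rfl⟩ := AddSubgroup.mem_sup.mp hs
    rw [AddMonoidHom.mem_ker, nsmulAddMonoidHom_apply, nsmulAddMonoidHom_apply, smul_add,
      smul_add] at hxTp
    rw [nsmulAddMonoidHom_apply, smul_add]
    have h1H : (p ^ j) • s₁ ∈ H := AddSubgroup.nsmul_mem _ hs₁ _
    have h2H' : (p ^ j) • s₂ ∈ H' := AddSubgroup.nsmul_mem _ hs₂ _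
    have hp1 : p • (p ^ j) • s₁ = 0 := by
      refine hHH' _ (AddSubgroup.nsmul_mem _ h1H _) ?_
      have : p • (p ^ j) • s₁ = -(p • (p ^ j) • s₂) := eq_neg_of_add_eq_zero_left hxTp
      rw [this]; exact AddSubgroup.neg_mem _ (AddSubgroup.nsmul_mem _ h2H' _)
    have hp2 : p • (p ^ j) • s₂ = 0 := by rwa [hp1, zero_add] at hxTp
    refine AddSubgroup.add_mem _ (AddSubgroup.mem_sup_right (AddSubgroup.mem_inf.mpr
      ⟨h1H, by rw [AddMonoidHom.mem_ker, nsmulAddMonoidHom_apply]; exact hp1⟩))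
      (AddSubgroup.mem_sup_left ?_)
    refine AddSubgroup.mem_map.mpr ⟨⟨(p ^ j) • s₂, h2H'⟩, AddSubgroup.mem_inf.mpr ⟨?_, ?_⟩, rfl⟩
    · exact ⟨⟨s₂, hs₂⟩, Subtype.ext (by rw [nsmulAddMonoidHom_apply, AddSubgroup.coe_nsmul])⟩
    · rw [AddMonoidHom.mem_ker, nsmulAddMonoidHom_apply]
      exact Subtype.ext (by rw [AddSubgroup.coe_nsmul, AddSubgroup.coe_zero]; exact hp2)
  haveI : Finite (F'.map H'.subtype) :=
    Finite.of_equiv _ (AddSubgroup.equivMapOfInjective _ H'.subtype H'.subtype_injective).toEquiv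
  calc Nat.card ↥((nsmulAddMonoidHom (p ^ j) : T →+ T).range ⊓ (nsmulAddMonoidHom p : T →+ T).ker)
      ≤ Nat.card ↥(F'.map H'.subtype ⊔ (H ⊓ (nsmulAddMonoidHom p : T →+ T).ker)) :=
        AddSubgroup.card_le_of_le hle
    _ ≤ Nat.card ↥(F'.map H'.subtype) * Nat.card ↥(H ⊓ (nsmulAddMonoidHom p : T →+ T).ker) :=
        card_sup_le_mul _ _
    _ = Nat.card F' * Nat.card ↥(H ⊓ (nsmulAddMonoidHom p : T →+ T).ker) := by
        rw [← Nat.card_congr (AddSubgroup.equivMapOfInjective _ H'.subtype H'.subtype_injective).toEquiv]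

/-- **A non-trivial character cuts by `p`.** If `Z` is a finite `p`-torsion subgroup and
`B(·, f)` does not vanish on `Z`, then `#(Z ∩ f^⊥) · p ≤ #Z` (`f^⊥ = ker B(·, f)`). [folklore] -/
theorem card_inf_ker_mul_le {p : ℕ} (hp : p.Prime) (Z : AddSubgroup T) [Finite Z]
    (hZp : ∀ z ∈ Z, p • z = 0) (f : T) (hex : ∃ y ∈ Z, B y f ≠ 0) :
    Nat.card ↥(Z ⊓ (B.flip f).ker) * p ≤ Nat.card Z := by
  haveI : Fact p.Prime := ⟨hp⟩
  set ψ : Z →+ AddCircle (1 : ℚ) := (B.flip f).comp Z.subtype with hψ_def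
  have hψ : ∀ y : Z, ψ y = B y f := fun y ↦ rfl
  have hker : Nat.card ψ.ker = Nat.card ↥(Z ⊓ (B.flip f).ker) := by
    have h1 : ψ.ker.map Z.subtype = Z ⊓ (B.flip f).ker := by
      ext t
      simp only [AddSubgroup.mem_map, AddMonoidHom.mem_ker, hψ, AddSubgroup.coe_subtype,
        AddSubgroup.mem_inf, AddMonoidHom.flip_apply]
      constructor
      · rintro ⟨y, hy, rfl⟩
        exact ⟨y.2, hy⟩
      · rintro ⟨htZ, htf⟩
        exact ⟨⟨t, htZ⟩, htf, rfl⟩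
    rw [← h1]
    exact Nat.card_congr (AddSubgroup.equivMapOfInjective ψ.ker Z.subtype Z.subtype_injective).toEquiv
  haveI : Finite ψ.range := Finite.of_surjective ψ.rangeRestrict ψ.rangeRestrict_surjective
  have hrange : p ≤ Nat.card ψ.range := by
    obtain ⟨y, hy, hyf⟩ := hex
    have hv : ψ ⟨y, hy⟩ ≠ 0 := by rw [hψ]; exact hyf
    have hpv : p • ψ ⟨y, hy⟩ = 0 := by
      rw [hψ, ← AddMonoidHom.nsmul_apply, ← map_nsmul, hZp y hy, map_zero, AddMonoidHom.zero_apply]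
    have hord : addOrderOf (⟨ψ ⟨y, hy⟩, ⟨_, rfl⟩⟩ : ψ.range) = p := by
      rw [← addOrderOf_injective ψ.range.subtype ψ.range.subtype_injective, AddSubgroup.coe_subtype]
      exact addOrderOf_eq_prime hpv hv
    rw [← hord]
    exact Nat.le_of_dvd Nat.card_pos (addOrderOf_dvd_natCard _)
  rw [card_eq_card_ker_mul_card_range ψ, hker]
  exact Nat.mul_le_mul_left _ hrange

/-! ### The trace of `Y` in the complement of a plane through `f` -/

/-- Elements of `(Y + ⟨f⟩) ∩ H'` for `Y ≤ T[p]`, `f ∈ H` of order `p^{a+1}`, `T = H ⊕ H'`,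
`H' ⊆ f^⊥`: `z = y + w` with `w ∈ ⟨p^a f⟩`, `y ∈ Y ∩ f^⊥`, and `p · z = 0`. [folklore] -/
theorem exists_decomp_of_mem_sup_zmultiples (halt : ∀ x, B x x = 0) {p : ℕ} (hp : p.Prime) {a : ℕ}
    {f : T} (hf : addOrderOf f = p ^ (a + 1)) {H H' : AddSubgroup T} (hc : IsCompl H H')
    (hfH : f ∈ H) (hH'f : ∀ t ∈ H', B t f = 0) {Y : AddSubgroup T} (hYp : ∀ y ∈ Y, p • y = 0)
    {z : T} (hzX : z ∈ Y ⊔ zmultiples f) (hzH' : z ∈ H') :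
    ∃ y ∈ Y, ∃ w ∈ zmultiples ((p ^ a) • f), z = y + w ∧ B y f = 0 ∧ p • z = 0 := by
  obtain ⟨y, hy, w, hw, rfl⟩ := AddSubgroup.mem_sup.mp hzX
  have hpw : p • w = 0 := by
    have hpz : p • (y + w) ∈ H' := AddSubgroup.nsmul_mem _ hzH' _
    rw [smul_add, hYp y hy, zero_add] at hpz
    exact (AddSubgroup.disjoint_def.mp hc.disjoint)
      ((AddSubgroup.zmultiples_le_of_mem hfH) (AddSubgroup.nsmul_mem _ hw _)) hpz
  have hw' := mem_zmultiples_nsmul_of_nsmul_eq_zero hp hf hw hpw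
  refine ⟨y, hy, w, hw', rfl, ?_, ?_⟩
  · have h1 : B (y + w) f = 0 := hH'f _ hzH'
    obtain ⟨c, rfl⟩ := AddSubgroup.mem_zmultiples_iff.mp hw'
    rw [map_add, AddMonoidHom.add_apply, map_zsmul, AddMonoidHom.zsmul_apply, map_nsmul,
      AddMonoidHom.nsmul_apply, halt f, smul_zero, smul_zero, add_zero] at h1
    exact h1
  · rw [smul_add, hYp y hy, hpw, add_zero]

/-- The trace `Y' = (Y + ⟨f⟩) ∩ H'` (as a subgroup of `H'`) is `p`-torsion. [folklore] -/
theorem trace_nsmul_eq_zero (halt : ∀ x, B x x = 0) {p : ℕ} (hp : p.Prime) {a : ℕ}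
    {f : T} (hf : addOrderOf f = p ^ (a + 1)) {H H' : AddSubgroup T} (hc : IsCompl H H')
    (hfH : f ∈ H) (hH'f : ∀ t ∈ H', B t f = 0) {Y : AddSubgroup T} (hYp : ∀ y ∈ Y, p • y = 0) :
    ∀ z ∈ (Y ⊔ zmultiples f).comap H'.subtype, p • z = 0 := by
  intro z hz
  have hz' : ((z : H') : T) ∈ Y ⊔ zmultiples f := AddSubgroup.mem_comap.mp hz
  obtain ⟨y, -, w, -, -, -, hpz⟩ :=
    exists_decomp_of_mem_sup_zmultiples B halt hp hf hc hfH hH'f hYp hz' z.2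
  exact Subtype.ext (by rw [AddSubgroup.coe_nsmul, AddSubgroup.coe_zero]; exact hpz)

/-- **The trace loses nothing but `⟨p^a f⟩`.** With the notation above and `j ≤ a`:
`#(Y' ∩ p^jH') ≤ #(Y ∩ f^⊥ ∩ p^jT)`. [folklore] -/
theorem card_trace_inf_range_le [Finite T] (halt : ∀ x, B x x = 0) {p : ℕ} (hp : p.Prime)
    {a j : ℕ} (hj : j ≤ a) {f : T} (hf : addOrderOf f = p ^ (a + 1)) {H H' : AddSubgroup T}
    (hc : IsCompl H H') (hfH : f ∈ H) (hH'f : ∀ t ∈ H', B t f = 0) {Y : AddSubgroup T}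
    (hYp : ∀ y ∈ Y, p • y = 0) :
    Nat.card ↥((Y ⊔ zmultiples f).comap H'.subtype ⊓ (nsmulAddMonoidHom (p ^ j) : H' →+ H').range) ≤
      Nat.card ↥((Y ⊓ (B.flip f).ker) ⊓ (nsmulAddMonoidHom (p ^ j) : T →+ T).range) := by
  set Y' : AddSubgroup H' := (Y ⊔ zmultiples f).comap H'.subtype with hY'_def
  set R' : AddSubgroup H' := (nsmulAddMonoidHom (p ^ j) : H' →+ H').range with hR'_def
  set R : AddSubgroup T := (nsmulAddMonoidHom (p ^ j) : T →+ T).range with hR_def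
  set Y₀ : AddSubgroup T := Y ⊓ (B.flip f).ker with hY₀_def
  set fbar : T := (p ^ a) • f with hfbar_def
  have hfbarR : fbar ∈ R :=
    ⟨(p ^ (a - j)) • f, by rw [nsmulAddMonoidHom_apply, hfbar_def, smul_smul, ← pow_add,
      Nat.add_sub_cancel' hj]⟩
  have hfbarH : fbar ∈ H := AddSubgroup.nsmul_mem _ hfH _
  set Z' : AddSubgroup T := (Y' ⊓ R').map H'.subtype with hZ'_def
  have hZ'le : Z' ≤ (Y₀ ⊓ R) ⊔ zmultiples fbar := by
    intro z hz
    obtain ⟨z₀, hz₀, rfl⟩ := AddSubgroup.mem_map.mp hz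
    obtain ⟨hz₀Y', hz₀R'⟩ := AddSubgroup.mem_inf.mp hz₀
    have hz₀X : ((z₀ : H') : T) ∈ Y ⊔ zmultiples f := AddSubgroup.mem_comap.mp hz₀Y'
    obtain ⟨y, hy, w, hw, hzyw, hByf, -⟩ := exists_decomp_of_mem_sup_zmultiples B halt hp hf hc hfH
      hH'f hYp hz₀X z₀.2
    have hzR : ((z₀ : H') : T) ∈ R := by
      obtain ⟨s, hs⟩ := hz₀R'
      refine ⟨(s : T), ?_⟩
      rw [nsmulAddMonoidHom_apply, ← hs, nsmulAddMonoidHom_apply, AddSubgroup.coe_nsmul]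
    have hyR : y ∈ R := by
      have : y = ((z₀ : H') : T) - w := by rw [hzyw, add_sub_cancel_right]
      rw [this]
      exact AddSubgroup.sub_mem _ hzR ((AddSubgroup.zmultiples_le_of_mem hfbarR) hw)
    rw [AddSubgroup.coe_subtype, hzyw]
    exact AddSubgroup.add_mem _ (AddSubgroup.mem_sup_left (AddSubgroup.mem_inf.mpr
      ⟨AddSubgroup.mem_inf.mpr ⟨hy, by rw [AddMonoidHom.mem_ker, AddMonoidHom.flip_apply]; exact hByf⟩,
        hyR⟩)) (AddSubgroup.mem_sup_right hw)
  have hZ'disj : Disjoint Z' (zmultiples fbar) := by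
    refine hc.symm.disjoint.mono ?_ (AddSubgroup.zmultiples_le_of_mem hfbarH)
    rw [hZ'_def]; exact AddSubgroup.map_subtype_le _
  have h1 := card_inf_mul_card_inf_le_of_disjoint hZ'disj ((Y₀ ⊓ R) ⊔ zmultiples fbar)
  rw [inf_eq_left.mpr hZ'le, inf_eq_left.mpr (le_sup_right (a := Y₀ ⊓ R))] at h1
  have h2 : Nat.card ↥((Y₀ ⊓ R) ⊔ zmultiples fbar) ≤ Nat.card ↥(Y₀ ⊓ R) * Nat.card (zmultiples fbar) :=
    card_sup_le_mul _ _
  have h3 : Nat.card Z' ≤ Nat.card ↥(Y₀ ⊓ R) :=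
    Nat.le_of_mul_le_mul_right (h1.trans h2) Nat.card_pos
  rwa [hZ'_def, Nat.card_congr (AddSubgroup.equivMapOfInjective _ H'.subtype
    H'.subtype_injective).toEquiv.symm] at h3

end LayeredLemmas

end Summit.BirchSwinnertonDyer.BirchSwinnertonDyer.Theorems.KolyvaginLiftGroupsTwo

end
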